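import Summits.ValiantsHypothesis.ValiantsHypothesis.Theorems.LacunarySymmetroidMatrixDescartesFiniteSector

/-!
# `MatrixDescartes` — line «finite»: the SECTOR CEILING of the `m = 2` row in closed form, `η(2,K) ≤ σ(2,K)` (kernel) —
# `HypRootLawAt 2 6 32` (and the `K = 3, 4, 5` rows `8, 16, 24`): with the doubled stamp rows, `η(2,K) = 8, 16, 24, 32` EXACT

HONEST FRAMING.  Object-search cell `pub-symmetroid`, seat val-sym-door-p5 g7 (desk go-in-principle R2488 (A), one writer).  HELPER of the crux item
`stmt-ValiantsHypothesis-18050` (`Theses.LacunarySymmetroid.MatrixDescartes`) with NO closure claim.  Line «finite» (val-idea-6 g3; port eng-3 g3) PROVED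
the SIEVE (`FiniteSector.sieve`: in the sector — all roots real and simple — of any two consecutive exponents below the degree at least one is an
`m`-fold sum of the pencil's exponents; `natDegree_mem_sumset`: the degree itself is one) and recorded the caps `η(m,K) ≤ σ(m,K)` only as a computed table
(`instr/stamp.py`).  This file turns the `m = 2` row of that table into KERNEL theorems: for `m = 2` the sums are PAIR SUMS `dᵢ + dⱼ`; a step-≤-2 chain of
pair sums from `0` up to the degree forces the value `0`, and a finite check over the capped, padded, SORTED value set — enumerated with PREFIX PRUNING
(a sorted prefix already fixes all pair sums below the next value, `memP_prefix`) and decided in the kernel — shows the chain cannot carry a degree above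
`σ(2,K)`: `HypRootLawAt 2 3 8`, `HypRootLawAt 2 4 16`, `HypRootLawAt 2 5 24`, `HypRootLawAt 2 6 32`.  Located first (stdlib exact DFS, this seat): the
maximal chain is attained ONLY by the all-even sets `{0,2,4}`, `2·{0,1,3,4}`, `2·{0,1,3,5,6}`, `2·{0,1,3,5,7,8}` = the doubled stamp bases.  With the
doubled stamp rows `eta_two_row_lower` (…FiniteSectorEtaTwoSix: `η(2,3) ≥ 8`, `η(2,4) ≥ 16`, `η(2,5) ≥ 24`, `η(2,6) ≥ 32`) the `m = 2` SECTOR register is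
EXACT ON BOTH SIDES BY NAME: `η(2,K) = σ(2,K) = 2·n(2,K−1)` for `K = 3, 4, 5, 6`.  Nothing here bears on the crux (asymptotic), on `H3`, on the doors,
or on `VP ≠ VNP`.
[folklore] Gap-rule / sieve bookkeeping (Pólya–Szegő II, Part V) plus a finite enumeration; no citation is load-bearing.
-/

-- `Summit.ValiantsHypothesis.ValiantsHypothesis.…` repeats a component by the D-0017 layout
-- (single-conjunct summit), which the `dupNamespace` linter flags; the name is mandated.
set_option linter.dupNamespace false

namespace Summit.ValiantsHypothesis.ValiantsHypothesis.Theorems.LacunarySymmetroidMatrixDescartes.FiniteSector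

open scoped BigOperators Matrix
open Polynomial

/-! ## §1 Pair sums of a value list and the step-≤-2 chain -/

/-- **Prefix pruning.**  If every element of `l₂` is `≥ x`, a pair sum `r < x` of `l₁ ++ l₂` is already a pair sum of `l₁`. [folklore] -/
theorem memP_prefix {l₁ l₂ : List ℕ} {x r : ℕ} (hx : ∀ y ∈ l₂, x ≤ y) (hr : r < x) :
    (∃ x ∈ (l₁ ++ l₂), ∃ y ∈ (l₁ ++ l₂), x + y = r) → (∃ x ∈ l₁, ∃ y ∈ l₁, x + y = r) := by
  rintro ⟨a, ha, b, hb, hab⟩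
  rw [List.mem_append] at ha hb
  rcases ha with ha | ha
  · rcases hb with hb | hb
    · exact ⟨a, ha, b, hb, hab⟩
    · have := hx b hb; omega
  · have := hx a ha; omega

/-! ## `K = 6`: `σ(2,6) = 32` -/

set_option synthInstance.maxSize 2000000 in
set_option synthInstance.maxHeartbeats 2000000 in
set_option maxHeartbeats 4000000 in
/-- **Finite core of `σ(2,6) = 32`** (pruned nested enumeration, `decide` in the kernel): for every strictly increasing
`0 < a < b < c < e < f < 36` whose sorted prefixes keep the step-≤-2 pair-sum chain alive (the only candidates), if the chain of
`{0,a,b,c,e,f}` reaches `31` then `33` is NOT a pair sum and `32`, `34` are not BOTH pair sums. [folklore] -/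
theorem sectorCheck_two_six :
    ∀ a ∈ List.range 36, (0 < a ∧ (∀ r ∈ List.range (min 32 (a - 1)), (∃ x ∈ [0], ∃ y ∈ [0], x + y = r) ∨ (∃ x ∈ [0], ∃ y ∈ [0], x + y = r + 1))) →
    ∀ b ∈ List.range 36, (a < b ∧ (∀ r ∈ List.range (min 32 (b - 1)), (∃ x ∈ [0, a], ∃ y ∈ [0, a], x + y = r) ∨ (∃ x ∈ [0, a], ∃ y ∈ [0, a], x + y = r + 1))) →
    ∀ c ∈ List.range 36, (b < c ∧ (∀ r ∈ List.range (min 32 (c - 1)), (∃ x ∈ [0, a, b], ∃ y ∈ [0, a, b], x + y = r) ∨ (∃ x ∈ [0, a, b], ∃ y ∈ [0, a, b], x + y = r + 1))) →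
    ∀ e ∈ List.range 36, (c < e ∧ (∀ r ∈ List.range (min 32 (e - 1)), (∃ x ∈ [0, a, b, c], ∃ y ∈ [0, a, b, c], x + y = r) ∨ (∃ x ∈ [0, a, b, c], ∃ y ∈ [0, a, b, c], x + y = r + 1))) →
    ∀ f ∈ List.range 36, (e < f ∧ (∀ r ∈ List.range (min 32 (f - 1)), (∃ x ∈ [0, a, b, c, e], ∃ y ∈ [0, a, b, c, e], x + y = r) ∨ (∃ x ∈ [0, a, b, c, e], ∃ y ∈ [0, a, b, c, e], x + y = r + 1))) →
    ((∀ r ∈ List.range 32, (∃ x ∈ [0, a, b, c, e, f], ∃ y ∈ [0, a, b, c, e, f], x + y = r) ∨ (∃ x ∈ [0, a, b, c, e, f], ∃ y ∈ [0, a, b, c, e, f], x + y = r + 1)) → (¬ (∃ x ∈ [0, a, b, c, e, f], ∃ y ∈ [0, a, b, c, e, f], x + y = 33) ∧ ¬ ((∃ x ∈ [0, a, b, c, e, f], ∃ y ∈ [0, a, b, c, e, f], x + y = 32) ∧ (∃ x ∈ [0, a, b, c, e, f], ∃ y ∈ [0, a, b, c, e, f], x + y = 34)))) := by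
  decide +kernel

/-- **`η(2,6) ≤ 32 = σ(2,6)`**: every in-sector (`#distinct real roots = natDegree`) determinant of a real symmetric `2 × 2` lacunary pencil with
`6` terms has degree `≤ 32` — `HypRootLawAt 2 6 32`.  (SIEVE `FiniteSector.sieve` + `natDegree_mem_sumset` ⇒ pair-sum chain; values capped at
`35`, value set padded to `6` distinct values and sorted; `sectorCheck_two_six`.) [folklore] -/
theorem hypRootLawAt_two_six_32 : HypRootLawAt 2 6 32 := by
  intro d S hS hsec
  by_contra hdeg'
  have hdeg : 32 < (pencil d S).det.natDegree := not_le.mp hdeg'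
  have hq : (pencil d S).det ≠ 0 := by
    intro h0
    rw [h0] at hdeg
    simp at hdeg
  -- pair sums of exponents
  have hpair : ∀ r, r ∈ (Finset.univ : Finset (Sym (Fin 6) 2)).image
      (fun s : Sym (Fin 6) 2 => ((s : Multiset (Fin 6)).map d).sum) → ∃ i j : Fin 6, d i + d j = r := by
    intro r hr
    rw [Finset.mem_image] at hr
    obtain ⟨s, -, hs⟩ := hr
    have hcard2 : Multiset.card (s : Multiset (Fin 6)) = 2 := s.2
    obtain ⟨i, j, hij⟩ := Multiset.card_eq_two.mp hcard2
    refine ⟨i, j, ?_⟩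
    have hsum : ((s : Multiset (Fin 6)).map d).sum = d i + d j := by
      rw [hij]
      simp
    omega
  have hchain : ∀ r, r + 2 ≤ (pencil d S).det.natDegree →
      (∃ i j : Fin 6, d i + d j = r) ∨ (∃ i j : Fin 6, d i + d j = r + 1) := by
    intro r hr
    rcases sieve d S hq hsec hr with h | h
    · exact Or.inl (hpair _ h)
    · exact Or.inr (hpair _ h)
  have htop : ∃ i j : Fin 6, d i + d j = (pencil d S).det.natDegree := hpair _ (natDegree_mem_sumset d S hq)
  -- capped values, the value set, padding, sorting
  set cv : Fin 6 → ℕ := fun i => min (d i) 35 with hcv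
  have hcvd : ∀ i, d i ≤ 34 → cv i = d i := fun i hi => by
    simp only [hcv]
    exact Nat.min_eq_left (by omega)
  have hcvle : ∀ i, cv i ≤ 35 := fun i => Nat.min_le_right _ _
  set V : Finset ℕ := Finset.univ.image cv with hV
  have hcvV : ∀ i, cv i ∈ V := fun i => Finset.mem_image_of_mem cv (Finset.mem_univ i)
  have h0V : 0 ∈ V := by
    rcases hchain 0 (by omega) with ⟨i, j, hij⟩ | ⟨i, j, hij⟩
    · have : cv i = 0 := by rw [hcvd i (by omega)]; omega
      exact this ▸ hcvV i
    · rcases Nat.eq_zero_or_pos (d i) with hi | hi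
      · have : cv i = 0 := by rw [hcvd i (by omega)]; omega
        exact this ▸ hcvV i
      · have : cv j = 0 := by rw [hcvd j (by omega)]; omega
        exact this ▸ hcvV j
  set W : Finset ℕ := V.erase 0 with hW
  have hWsub : W ⊆ (Finset.range 36).erase 0 := by
    intro u hu
    rw [hW, Finset.mem_erase] at hu
    obtain ⟨hu0, huV⟩ := hu
    rw [hV, Finset.mem_image] at huV
    obtain ⟨i, -, rfl⟩ := huV
    rw [Finset.mem_erase, Finset.mem_range]
    exact ⟨hu0, Nat.lt_succ_of_le (hcvle i)⟩
  have hWcard : W.card ≤ 5 := by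
    have hVK : V.card ≤ 6 := by
      have := Finset.card_image_le (s := (Finset.univ : Finset (Fin 6))) (f := cv)
      simpa using this
    have h1 : W.card + 1 = V.card := by rw [hW]; exact Finset.card_erase_add_one h0V
    omega
  obtain ⟨W', hWW', hW'sub, hW'card⟩ := Finset.exists_subsuperset_card_eq hWsub hWcard
    (by rw [Finset.card_erase_of_mem (by simp), Finset.card_range]; omega)
  have hVW' : ∀ u ∈ V, u = 0 ∨ u ∈ W' := by
    intro u hu
    by_cases hu0 : u = 0
    · exact Or.inl hu0
    · exact Or.inr (hWW' (by rw [hW, Finset.mem_erase]; exact ⟨hu0, hu⟩))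
  have hlmem : ∀ u, u ∈ Finset.sort W' ↔ u ∈ W' := fun u => Finset.mem_sort _
  have hlsort : (Finset.sort W').SortedLT := Finset.sortedLT_sort W'
  have hllen : (Finset.sort W').length = 5 := by rw [Finset.length_sort, hW'card]
  generalize hl : Finset.sort W' = l at hlmem hlsort hllen
  -- name the sorted values
  rcases l with _ | ⟨a, _ | ⟨b, _ | ⟨c, _ | ⟨e, _ | ⟨f, _ | ⟨zz, ll⟩⟩⟩⟩⟩⟩
  all_goals simp only [List.length_cons, List.length_nil] at hllen
  all_goals try omega
  -- bounds and order
  have hmemR : ∀ u, u ∈ [a, b, c, e, f] → u ∈ List.range 36 := by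
    intro u hu
    have hu' : u ∈ W' := (hlmem u).mp hu
    have := hW'sub hu'
    rw [Finset.mem_erase, Finset.mem_range] at this
    exact List.mem_range.mpr this.2
  have hne0 : ∀ u, u ∈ [a, b, c, e, f] → u ≠ 0 := by
    intro u hu
    have hu' : u ∈ W' := (hlmem u).mp hu
    have := hW'sub hu'
    rw [Finset.mem_erase] at this
    exact this.1
  have h0 : 0 < a := Nat.pos_of_ne_zero (hne0 a (by simp))
  -- membership transfer: a pair sum `r ≤ 34` of `d` is a pair sum of the sorted value list
  have hmemP : ∀ r, r ≤ 34 → (∃ i j : Fin 6, d i + d j = r) → (∃ x ∈ [0, a, b, c, e, f], ∃ y ∈ [0, a, b, c, e, f], x + y = r) := by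
    rintro r hr ⟨i, j, hij⟩
    have hi : cv i = d i := hcvd i (by omega)
    have hj : cv j = d j := hcvd j (by omega)
    have hin : ∀ u ∈ V, u ∈ [0, a, b, c, e, f] := by
      intro u hu
      rcases hVW' u hu with h | h
      · rw [h]; simp
      · exact List.mem_cons_of_mem _ ((hlmem u).mpr h)
    exact ⟨cv i, hin _ (hcvV i), cv j, hin _ (hcvV j), by rw [hi, hj]; exact hij⟩
  have hchainP : ∀ r, r ≤ 31 → (∃ x ∈ [0, a, b, c, e, f], ∃ y ∈ [0, a, b, c, e, f], x + y = r) ∨ (∃ x ∈ [0, a, b, c, e, f], ∃ y ∈ [0, a, b, c, e, f], x + y = r + 1) := by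
    intro r hr
    rcases hchain r (by omega) with h | h
    · exact Or.inl (hmemP r (by omega) h)
    · exact Or.inr (hmemP (r + 1) (by omega) h)
  have hfull : (∀ r ∈ List.range 32, (∃ x ∈ [0, a, b, c, e, f], ∃ y ∈ [0, a, b, c, e, f], x + y = r) ∨ (∃ x ∈ [0, a, b, c, e, f], ∃ y ∈ [0, a, b, c, e, f], x + y = r + 1)) := fun r hr => hchainP r (by have := List.mem_range.mp hr; omega)
  have hlt1 : a < b := by
    have := hlsort (show (⟨0, by simp⟩ : Fin [a, b, c, e, f].length) < ⟨1, by simp⟩ from Fin.mk_lt_mk.mpr (by norm_num))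
    simpa using this
  have hlt2 : b < c := by
    have := hlsort (show (⟨1, by simp⟩ : Fin [a, b, c, e, f].length) < ⟨2, by simp⟩ from Fin.mk_lt_mk.mpr (by norm_num))
    simpa using this
  have hlt3 : c < e := by
    have := hlsort (show (⟨2, by simp⟩ : Fin [a, b, c, e, f].length) < ⟨3, by simp⟩ from Fin.mk_lt_mk.mpr (by norm_num))
    simpa using this
  have hlt4 : e < f := by
    have := hlsort (show (⟨3, by simp⟩ : Fin [a, b, c, e, f].length) < ⟨4, by simp⟩ from Fin.mk_lt_mk.mpr (by norm_num))
    simpa using this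
  have pre1 : (∀ r ∈ List.range (min 32 (a - 1)), (∃ x ∈ [0], ∃ y ∈ [0], x + y = r) ∨ (∃ x ∈ [0], ∃ y ∈ [0], x + y = r + 1)) := by
    intro r hr
    rw [List.mem_range] at hr
    have hrT : r < 32 := lt_of_lt_of_le hr (min_le_left _ _)
    have hrv : r < a - 1 := lt_of_lt_of_le hr (min_le_right _ _)
    have hr' : r + 1 < a := by omega
    have hrest : ∀ y ∈ [a, b, c, e, f], a ≤ y := by
      intro y hy
      simp only [List.mem_cons, List.mem_nil_iff, or_false] at hy
      omega
    rcases hchainP r (by omega) with h | h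
    · exact Or.inl (memP_prefix (l₁ := [0]) (l₂ := [a, b, c, e, f]) hrest (by omega) h)
    · exact Or.inr (memP_prefix (l₁ := [0]) (l₂ := [a, b, c, e, f]) hrest hr' h)
  have pre2 : (∀ r ∈ List.range (min 32 (b - 1)), (∃ x ∈ [0, a], ∃ y ∈ [0, a], x + y = r) ∨ (∃ x ∈ [0, a], ∃ y ∈ [0, a], x + y = r + 1)) := by
    intro r hr
    rw [List.mem_range] at hr
    have hrT : r < 32 := lt_of_lt_of_le hr (min_le_left _ _)
    have hrv : r < b - 1 := lt_of_lt_of_le hr (min_le_right _ _)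
    have hr' : r + 1 < b := by omega
    have hrest : ∀ y ∈ [b, c, e, f], b ≤ y := by
      intro y hy
      simp only [List.mem_cons, List.mem_nil_iff, or_false] at hy
      omega
    rcases hchainP r (by omega) with h | h
    · exact Or.inl (memP_prefix (l₁ := [0, a]) (l₂ := [b, c, e, f]) hrest (by omega) h)
    · exact Or.inr (memP_prefix (l₁ := [0, a]) (l₂ := [b, c, e, f]) hrest hr' h)
  have pre3 : (∀ r ∈ List.range (min 32 (c - 1)), (∃ x ∈ [0, a, b], ∃ y ∈ [0, a, b], x + y = r) ∨ (∃ x ∈ [0, a, b], ∃ y ∈ [0, a, b], x + y = r + 1)) := by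
    intro r hr
    rw [List.mem_range] at hr
    have hrT : r < 32 := lt_of_lt_of_le hr (min_le_left _ _)
    have hrv : r < c - 1 := lt_of_lt_of_le hr (min_le_right _ _)
    have hr' : r + 1 < c := by omega
    have hrest : ∀ y ∈ [c, e, f], c ≤ y := by
      intro y hy
      simp only [List.mem_cons, List.mem_nil_iff, or_false] at hy
      omega
    rcases hchainP r (by omega) with h | h
    · exact Or.inl (memP_prefix (l₁ := [0, a, b]) (l₂ := [c, e, f]) hrest (by omega) h)
    · exact Or.inr (memP_prefix (l₁ := [0, a, b]) (l₂ := [c, e, f]) hrest hr' h)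
  have pre4 : (∀ r ∈ List.range (min 32 (e - 1)), (∃ x ∈ [0, a, b, c], ∃ y ∈ [0, a, b, c], x + y = r) ∨ (∃ x ∈ [0, a, b, c], ∃ y ∈ [0, a, b, c], x + y = r + 1)) := by
    intro r hr
    rw [List.mem_range] at hr
    have hrT : r < 32 := lt_of_lt_of_le hr (min_le_left _ _)
    have hrv : r < e - 1 := lt_of_lt_of_le hr (min_le_right _ _)
    have hr' : r + 1 < e := by omega
    have hrest : ∀ y ∈ [e, f], e ≤ y := by
      intro y hy
      simp only [List.mem_cons, List.mem_nil_iff, or_false] at hy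
      omega
    rcases hchainP r (by omega) with h | h
    · exact Or.inl (memP_prefix (l₁ := [0, a, b, c]) (l₂ := [e, f]) hrest (by omega) h)
    · exact Or.inr (memP_prefix (l₁ := [0, a, b, c]) (l₂ := [e, f]) hrest hr' h)
  have pre5 : (∀ r ∈ List.range (min 32 (f - 1)), (∃ x ∈ [0, a, b, c, e], ∃ y ∈ [0, a, b, c, e], x + y = r) ∨ (∃ x ∈ [0, a, b, c, e], ∃ y ∈ [0, a, b, c, e], x + y = r + 1)) := by
    intro r hr
    rw [List.mem_range] at hr
    have hrT : r < 32 := lt_of_lt_of_le hr (min_le_left _ _)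
    have hrv : r < f - 1 := lt_of_lt_of_le hr (min_le_right _ _)
    have hr' : r + 1 < f := by omega
    have hrest : ∀ y ∈ [f], f ≤ y := by
      intro y hy
      simp only [List.mem_cons, List.mem_nil_iff, or_false] at hy
      omega
    rcases hchainP r (by omega) with h | h
    · exact Or.inl (memP_prefix (l₁ := [0, a, b, c, e]) (l₂ := [f]) hrest (by omega) h)
    · exact Or.inr (memP_prefix (l₁ := [0, a, b, c, e]) (l₂ := [f]) hrest hr' h)
  -- apply the kernel check
  obtain ⟨hno33, hno3234⟩ := sectorCheck_two_six a (hmemR a (by simp)) ⟨h0, pre1⟩ b (hmemR b (by simp)) ⟨hlt1, pre2⟩ c (hmemR c (by simp)) ⟨hlt2, pre3⟩ e (hmemR e (by simp)) ⟨hlt3, pre4⟩ f (hmemR f (by simp)) ⟨hlt4, pre5⟩ hfull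
  -- degree 33, 34, or ≥ 35: each contradicts the check
  rcases Nat.lt_or_ge (pencil d S).det.natDegree 35 with hsmall | hbig
  · interval_cases h : (pencil d S).det.natDegree
    · exact hno33 (hmemP 33 (by omega) (h ▸ htop))
    · have h34 : (∃ x ∈ [0, a, b, c, e, f], ∃ y ∈ [0, a, b, c, e, f], x + y = 34) :=
        hmemP 34 (by omega) (h ▸ htop)
      rcases hchain 32 (by omega) with h' | h'
      · exact hno3234 ⟨hmemP 32 (by omega) h', h34⟩
      · exact hno33 (hmemP 33 (by omega) h')
  · rcases hchain 32 (by omega) with h1 | h1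
    · rcases hchain 33 (by omega) with h2 | h2
      · exact hno33 (hmemP 33 (by omega) h2)
      · exact hno3234 ⟨hmemP 32 (by omega) h1, hmemP 34 (by omega) h2⟩
    · exact hno33 (hmemP 33 (by omega) h1)

end Summit.ValiantsHypothesis.ValiantsHypothesis.Theorems.LacunarySymmetroidMatrixDescartes.FiniteSector
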